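/-
Copyright (c) 2026 the pub-hodgecm-mathlib formalisation cell (harness21).  Prover seat hodgecm-mathlib-K2E5-p02 (g0),
Track B «K2-LIT» ∕ h413, engine E5 «TamagawaUnitary», unit HAAR-FIBRATION (NODE II), file #2: payment of the socket
`K2E5TamagawaUnitary.HaarFibration.sig_K2E5HaarKerLiftHomeomorph` — FOR A CONTINUOUS OPEN SURJECTIVE HOMOMORPHISM
`φ : G →* Q` THE CANONICAL MAP `G ⧸ ker φ → Q` IS A HOMEOMORPHISM.  2026-09-03.
-/
import Mathlib.Topology.Algebra.Group.Quotient     -- quotient topology on `G ⧸ N`, `QuotientGroup.isQuotientMap_mk`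
import Mathlib.GroupTheory.QuotientGroup.Basic     -- `QuotientGroup.kerLift`, `kerLift_mk`, `kerLift_injective`
import Mathlib.Topology.Homeomorph.Lemmas          -- `IsHomeomorph`
import HarnessLib

/-!
# K2_E5 road (h413 = stmt-HodgeConjecture-24833), unit HAAR-FIBRATION, file #2:
# `kerLift φ : G ⧸ ker φ → Q` is a homeomorphism for `φ` continuous, open and surjective

Cell `pub/hodgecm-mathlib` (D-0151), Track B (21-frontier RULING «PUSH BOTH» 2026-09-03, director req624, chair K2-lead,
SKELETON LANDED K2E5 l.72414), socket module
`Summits/HodgeConjecture/HodgeConjecture/Cruxes/H413/Lines/K2_E5_TamagawaUnitary_HaarFibration.lean` (planner K2E5-plan (g0)),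
socket **`sig_K2E5HaarKerLiftHomeomorph`** (HaarFibration :48, size S): for topological groups `G`, `Q` and a continuous,
open, surjective homomorphism `φ : G →* Q`, the canonical group homomorphism `QuotientGroup.kerLift φ : G ⧸ ker φ →* Q`
(`kerLift φ (g · ker φ) = φ g`) is a homeomorphism.  This is the topological half of the «suite exacte de groupes topologiques
… continues» `1 → N → G →φ Q → 1` along which the Haar measures of the HAAR-FIBRATION unit are made compatible
(`dz = dy dt`); in the DET-FIBRATION instantiation `G = U(h)(𝔸)`, `N = SU(h)(𝔸) = ker det`, `Q = U(1)(𝔸)`, `φ = det`.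
[Deitmar–Echterhoff, *Principles of Harmonic Analysis*, Thm. 1.5.3; Vignéras, LNM 800, Ch. II §4.]

THE MATHEMATICS (elementary point-set topology; Mathlib only).  Write `π : G → G ⧸ ker φ` for the quotient map, so that
`kerLift φ ∘ π = φ` (Mathlib `QuotientGroup.kerLift_mk`, definitional).
* bijective: `kerLift φ` is injective (Mathlib `QuotientGroup.kerLift_injective`) and surjective because `φ` is
  (`q = φ g = kerLift φ (π g)`);
* continuous: `π` is a topological quotient map (Mathlib `QuotientGroup.isQuotientMap_mk`), and `kerLift φ ∘ π = φ` is
  continuous, so `kerLift φ` is continuous (`IsQuotientMap.continuous_iff`);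
* open: for `U ⊆ G ⧸ ker φ` open, `kerLift φ '' U = φ '' (π ⁻¹' U)` (`π` is surjective), and `π ⁻¹' U` is open by continuity
  of `π`, so its image under the OPEN map `φ` is open.
Mathlib's `IsHomeomorph f` is exactly the conjunction `Continuous f ∧ IsOpenMap f ∧ Bijective f`.  The binders
`[IsTopologicalGroup G] [IsTopologicalGroup Q]` of the socket are carried verbatim but not used by the proof (the three
steps need no compatibility of the topologies with the group laws).

* §1 generic lemmas on `QuotientGroup.kerLift` (bare groups, resp. groups with a topology — no compatibility assumed):
  `kerLift_comp_mk`, `kerLift_surjective`, `image_kerLift_eq`; `continuous_kerLift`, `isOpenMap_kerLift`.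
* §2 **`haarKerLiftHomeomorph`** — `sig_K2E5HaarKerLiftHomeomorph` TOKEN FOR TOKEN (kernel certificate of the token identity
  at home: `K2/K2E5-p02/g0/Probe_K2E5HaarKerLiftHomeomorph.lean`, `example : type_of% @… = type_of% @… := rfl`).

HONEST LABEL: HC_CM is proved only modulo the 7 printed citations (2 remaining named inputs: hLiu418 =
stmt-HodgeConjecture-24832, h413 = stmt-HodgeConjecture-24833) until rung 0 closes; this file is a
`--supports stmt-HodgeConjecture-24833 --as helper` leaf (rung :48 of unit HAAR-FIBRATION of the K2_E5 road) and retires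
nothing by itself.
-/

set_option autoImplicit false
set_option linter.dupNamespace false   -- `Summit.HodgeConjecture.HodgeConjecture.…` (D-0017 nested layout; lakefile exemption for Summits)

namespace Summit.HodgeConjecture.HodgeConjecture.Cruxes.H413.K2E5HaarKerLiftHomeomorph

/-! ## §1  `kerLift`: surjective (bare groups); continuous, open (over topological spaces) -/

section KerLift

variable {G Q : Type*} [Group G] [Group Q] (φ : G →* Q)

/-- `kerLift φ ∘ π = φ` for the quotient map `π : G → G ⧸ ker φ` (Mathlib `QuotientGroup.kerLift_mk`, pointwise `rfl`). [folklore] -/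
theorem kerLift_comp_mk : (QuotientGroup.kerLift φ ∘ QuotientGroup.mk : G → Q) = φ :=
  funext fun g => QuotientGroup.kerLift_mk φ g

/-- If `φ : G →* Q` is surjective then so is `kerLift φ : G ⧸ ker φ → Q`: `q = φ g = kerLift φ (π g)`. [folklore] -/
theorem kerLift_surjective (hφs : Function.Surjective φ) : Function.Surjective (QuotientGroup.kerLift φ) := by
  intro q
  obtain ⟨g, rfl⟩ := hφs q
  exact ⟨QuotientGroup.mk g, QuotientGroup.kerLift_mk φ g⟩

/-- The image of `U ⊆ G ⧸ ker φ` under `kerLift φ` is the image of `π ⁻¹' U ⊆ G` under `φ` (the quotient map `π` is surjective).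
[folklore] -/
theorem image_kerLift_eq (U : Set (G ⧸ φ.ker)) :
    QuotientGroup.kerLift φ '' U = φ '' (QuotientGroup.mk ⁻¹' U) := by
  ext q
  constructor
  · rintro ⟨x, hx, rfl⟩
    induction x using QuotientGroup.induction_on with
    | H g => exact ⟨g, hx, (QuotientGroup.kerLift_mk φ g).symm⟩
  · rintro ⟨g, hg, rfl⟩
    exact ⟨QuotientGroup.mk g, hg, QuotientGroup.kerLift_mk φ g⟩

variable [TopologicalSpace G] [TopologicalSpace Q]

/-- If `φ : G →* Q` is continuous then so is `kerLift φ : G ⧸ ker φ → Q`, because the quotient map `π : G → G ⧸ ker φ` is a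
topological quotient map and `kerLift φ ∘ π = φ`. [cite: DeitmarEchterhoff2014, Thm. 1.5.3] -/
theorem continuous_kerLift (hφc : Continuous φ) : Continuous (QuotientGroup.kerLift φ) := by
  rw [(QuotientGroup.isQuotientMap_mk φ.ker).continuous_iff, kerLift_comp_mk]
  exact hφc

/-- If `φ : G →* Q` is an open map then so is `kerLift φ : G ⧸ ker φ → Q`: `kerLift φ '' U = φ '' (π ⁻¹' U)` with `π ⁻¹' U`
open by continuity of the quotient map `π`. [cite: DeitmarEchterhoff2014, Thm. 1.5.3] -/
theorem isOpenMap_kerLift (hφo : IsOpenMap φ) : IsOpenMap (QuotientGroup.kerLift φ) := by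
  intro U hU
  rw [image_kerLift_eq]
  exact hφo _ (hU.preimage QuotientGroup.continuous_mk)

end KerLift

/-! ## §2  The head -/

/-- **PAYMENT OF `sig_K2E5HaarKerLiftHomeomorph`** (socket :48 of unit HAAR-FIBRATION of the K2_E5 road,
`Cruxes/H413/Lines/K2_E5_TamagawaUnitary_HaarFibration.lean`, TOKEN FOR TOKEN): for topological groups `G`, `Q` and a
continuous OPEN surjective homomorphism `φ : G →* Q`, the canonical bijection `G ⧸ ker φ → Q` (Mathlib
`QuotientGroup.kerLift`) is a homeomorphism — continuous (lift of `φ` through the quotient map), open (`φ` open, quotient map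
surjective and continuous) and bijective (`kerLift_injective` + surjectivity of `φ`).  Printed: for an exact sequence of
locally compact groups `1 → N → G → Q → 1` with `G → Q` continuous and open, `G ⧸ N ≅ Q` as topological groups.
[cite: DeitmarEchterhoff2014, Thm. 1.5.3] [cite: VignerasLNM800, Ch. II §4 («Mesures compatibles»)] -/
theorem haarKerLiftHomeomorph :
    ∀ {G Q : Type} [Group G] [TopologicalSpace G] [IsTopologicalGroup G] [Group Q] [TopologicalSpace Q] [IsTopologicalGroup Q]
      (φ : G →* Q) (_ : Continuous φ) (_ : IsOpenMap φ) (_ : Function.Surjective φ),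
      IsHomeomorph (QuotientGroup.kerLift φ) := by
  intro G Q _ _ _ _ _ _ φ hφc hφo hφs
  exact ⟨continuous_kerLift φ hφc, isOpenMap_kerLift φ hφo, QuotientGroup.kerLift_injective φ, kerLift_surjective φ hφs⟩

end Summit.HodgeConjecture.HodgeConjecture.Cruxes.H413.K2E5HaarKerLiftHomeomorph
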